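import Summits.BirchSwinnertonDyer.BirchSwinnertonDyer.Theorems.EisensteinPrimesCharLocalInertiaBounds
import Summits.BirchSwinnertonDyer.BirchSwinnertonDyer.Theorems.EisensteinPrimesTwoVariableOmegaBranchCharacters
import Summits.BirchSwinnertonDyer.Rank1Residual.X2.NonPrimitiveQuotientCorank
import Literature.NumberTheory.EllipticCurves.H1TrivialAction
import Literature.NumberTheory.Automorphic.AdicCompletionResidueCard
import HarnessLib

/-!
# The Frobenius case of KY Lemma 1.1.1 in the kernel: at `v ∤ p` with `θ` unramified and
# `θ(Frob_v) ≢ Nv (mod 𝔭)` the image of `H¹(K_∞, (F/𝒪)(θ)) → H¹(I_w, (F/𝒪)(θ))` has NO `p`-torsion;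
# hence the per-place corank bound `c_v ≤ 𝟙[FrobActsAsNormAt ∅ θ v]`

Cell `bsd-eis` (home `run/shared/lean/pub/bsd-eis/`), seat `bsd-line-x1-p1-w2` (D-0154 width seat on
crux 2 `GoodLatticeBDPValue` = stmt-BirchSwinnertonDyer-19032, line `halves` v14, stub
`stub_imprimCorank`), step 3b of the unconditional `≤`-direction of
`KellerYin2024.prop125_residualPair_unrSelmer_corank`. Sequel of `EisensteinPrimesCharLocalInertiaBounds`:

* §1 `resH1Hom_inertiaIn_eq_zero_of_prime_nsmul_eq_zero` — for `θ` unramified at `v` (locally: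
  `θ` kills `res (I_{K_v})`), `I_v ≤ H`, `H ∋` the prime-to-`p` parts of local Frobenii (e.g.
  `H = ker κ`), and a local Frobenius `φ` with `unitChar θ (res φ) − q_v ∉ 𝔪_{ℤ_p}`: every class of
  `H¹(H, (F/𝒪)(θ))` whose restriction to `H ∩ I_v` is `p`-torsion restricts to ZERO (the abstract
  `CharLocalInertiaBounds.hom_apply_eq_zero_of_conj` applied to a cocycle of the class, with `g` the
  prime-to-`p` part of `φ`, which acts on `M[p]` like `φ`, i.e. by the integer `appr (θ(φ)) 1`).
* §2 `zpCorank_le_ite_of_forall_exists` — the PER-PLACE input `hloc` of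
  `UnrSelmerQuotientCorankLeGeneric.zpCorank_quotient_le_sum` for `M = (F/𝒪)(θ)`, `θ^{p−1} = 1`,
  `H = ker κ`, `v ∤ p`: every subgroup `Y` of the image of
  `r_v : H¹(K_∞, M) → H¹(I_w(K_∞), M)` has `zpCorank Y p ≤ (if FrobActsAsNormAt ∅ θ v then 1 else 0)`
  (so `numPlacesAbove κ v * c_v = charLocalLambda ∅ κ θ v` on the nose): `≤ 1` from `#H¹[p] ≤ p`;
  `= 0` for `θ` ramified (§3 of the prequel) and for `θ` unramified with `θ(Frob_v) ≢ Nv` (§1, the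
  Frobenius value being read through `hasFrobCharpolyAt_entry_of_isUnramifiedAt` and the isometry
  `ℤ_p ≅ 𝒪_{ℚ_p(∅)}`).

HONEST FRAMING: tool theorems only (no definition, no named fact, no `sorry`); closes nothing by
itself (`--supports stmt-BirchSwinnertonDyer-19032`); BSD / Mazur's main conjecture is proved for no curve.

References: Keller–Yin arXiv:2402.12781v2 Lemma 1.1.1; Castella–Grossi–Lee–Skinner 2022 Lemma 1.1.1;
Greenberg–Vatsal 2000 §2 Prop. (2.4); Greenberg 1989 §2 Prop. 2; Serre 1972 §1.8 Prop. 6.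
-/

-- `Summit.BirchSwinnertonDyer.BirchSwinnertonDyer.…`: summit and sub-problem share a name (D-0017 layout).
set_option linter.dupNamespace false
set_option autoImplicit false

noncomputable section

open scoped Classical AddSubgroup Pointwise

open CategoryTheory Function Filter Polynomial NumberField IsDedekindDomain Field ValuativeRel
open Literature.NumberTheory.EllipticCurves Literature.NumberTheory.EllipticCurves.GreenbergSelmer
  Literature.NumberTheory.GaloisRepresentations
  Literature.NumberTheory.GaloisRepresentations.IsNonarchimedeanLocalField
  Literature.NumberTheory.EllipticCurves.KellerYin2024 Literature.NumberTheory.IwasawaTheory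
  Summit.BirchSwinnertonDyer.Rank1Residual
  Summit.BirchSwinnertonDyer.Rank1Residual.X2.NonPrimitiveQuotientCorank
  Summit.BirchSwinnertonDyer.BirchSwinnertonDyer.Theorems.CharLocalInertiaBounds

namespace Summit.BirchSwinnertonDyer.BirchSwinnertonDyer.Theorems.CharLocalInertiaFrobenius

variable {K : Type} [Field K] [NumberField K] {p : ℕ} [hp : Fact p.Prime]
  (θ : FramedGaloisRep K (padicCoeffIntegers (∅ : Set (PadicAlgCl p))) 1)
  (H : Subgroup (absoluteGaloisGroup K)) (v : HeightOneSpectrum (𝓞 K))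

/-! ## §0 Plumbing on the character module -/

omit [NumberField K] in
/-- `θ σ = 1 ⟹ unitChar θ σ = 1`. [cite: KellerYin2024, §1.1 (arXiv:2402.12781v2 TeX L441–449)] -/
theorem unitChar_eq_one_of_apply_eq_one {σ : absoluteGaloisGroup K} (h : θ σ = 1) :
    unitChar θ σ = 1 := by
  change (Units.map (padicIntEquivCoeffIntegersEmpty p).symm.toRingHom.toMonoidHom)
      (Matrix.GeneralLinearGroup.det (θ σ)) = 1
  rw [h, map_one, map_one]

omit [NumberField K] in
/-- An element with `θ σ = 1` acts trivially on `(F/𝒪)(θ)`. [cite: KellerYin2024, §1.1 (arXiv:2402.12781v2 TeX L441–449)] -/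
theorem smul_eq_self_of_apply_eq_one {σ : absoluteGaloisGroup K} (h : θ σ = 1)
    (m : charModule (∅ : Set (PadicAlgCl p)) θ) : σ • m = m :=
  (charModuleEquiv θ).injective (by
    rw [charModuleEquiv_galois_smul, unitChar_eq_one_of_apply_eq_one θ h, Units.val_one, one_smul])

omit [NumberField K] in
/-- **A unit `u ∈ ℤ_p` acts on the `p`-torsion of `(F/𝒪)(θ) ≅ ℚ_p/ℤ_p` as the integer `appr u 1`**, and
so does every `σ` with `unitChar θ σ = u`: `σ • d = (appr u 1) • d` for `p • d = 0`.
[cite: KellerYin2024, §1.1 (arXiv:2402.12781v2 TeX L441–449)] -/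
theorem smul_eq_appr_smul_of_prime_nsmul_eq_zero (σ : absoluteGaloisGroup K)
    (d : charModule (∅ : Set (PadicAlgCl p)) θ) (hd : p • d = 0) :
    σ • d = ((unitChar θ σ : ℤ_[p]ˣ) : ℤ_[p]).appr 1 • d := by
  apply (charModuleEquiv θ).injective
  have hd' : p ^ 1 • charModuleEquiv θ d = 0 := by rw [pow_one, ← map_nsmul, hd, map_zero]
  rw [charModuleEquiv_galois_smul, map_nsmul, QpModZp.smul_eq_appr_smul_of_nsmul_eq_zero hd']

omit [NumberField K] in
/-- Powers `σ^{p^m}` act on the `p`-torsion of `(F/𝒪)(θ)` like `σ` (`u^{p^m} ≡ u (mod p)`). [folklore] -/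
theorem pow_prime_pow_smul_eq_smul (σ : absoluteGaloisGroup K)
    (d : charModule (∅ : Set (PadicAlgCl p)) θ) (hd : p • d = 0) (m : ℕ) :
    (σ ^ p ^ m) • d = σ • d := by
  apply (charModuleEquiv θ).injective
  have hd' : p ^ 1 • charModuleEquiv θ d = 0 := by rw [pow_one, ← map_nsmul, hd, map_zero]
  rw [charModuleEquiv_galois_smul, charModuleEquiv_galois_smul, map_pow, Units.val_pow_eq_pow_val]
  refine QpModZp.smul_eq_of_sub_mem_of_nsmul_eq_zero hd' ?_
  rw [pow_one, ← PadicInt.maximalIdeal_eq_span_p, ← PadicInt.ker_toZMod, RingHom.mem_ker, map_sub,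
    map_pow, ZMod.pow_card_pow, sub_self]

/-! ## §1 Frobenius-stable `p`-torsion classes in the image vanish when `θ(Frob_v) ≢ q_v (mod p)` -/

/-- **At `v ∤ p` with `θ` unramified (locally: `θ` kills `res (I_{K_v})`) and
`θ(Frob_v) ≢ q_v (mod p)`, every class of `H¹(H, (F/𝒪)(θ))` whose restriction to `H ∩ I_v` is
`p`-torsion restricts to ZERO** — for `I_v ≤ H` and `H` containing the restriction of every element
of `Γ_{K_v}` killed by all continuous `Γ_{K_v} → ℤ_p` (e.g. `H = ker κ`). Proof: inflate to
`absInertia K_v` (injective) and apply `CharLocalInertiaBounds.hom_apply_eq_zero_of_conj` to a cocycle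
`F` of the class restricted along `absInertia K_v → H` (a continuous HOMOMORPHISM, the inertia action
being trivial; `p`-torsion classes are `p`-torsion maps), with `g` the prime-to-`p` part of the
Frobenius `φ` (`FrobeniusPrimeToPPart`; `res g ∈ H`), which acts on `M[p]` like `φ`, i.e. as the
integer `a = appr (unitChar θ (res φ)) 1` (`pow_prime_pow_smul_eq_smul`,
`smul_eq_appr_smul_of_prime_nsmul_eq_zero`); invariance `g • F(g⁻¹σg) = F(σ)` is the cocycle identity
at `res g ∈ H`; and `p ∤ q_v − a` because `unitChar θ (res φ) − q_v ∉ 𝔪`. The case `d = 0`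
("`θ(Frob_w) ≢ ℓ`", `𝒫_w(θ) = 1 − θ(Frob_w)ℓ⁻¹γ_w` a unit) of KY Lemma 1.1.1 on the inertia side.
[cite: KellerYin2024, Lemma 1.1.1 (arXiv:2402.12781v2 TeX L455–462)] [cite: GreenbergVatsal2000, §2 Prop. (2.4) pp. 22–23] -/
theorem resH1Hom_inertiaIn_eq_zero_of_prime_nsmul_eq_zero (hpv : (p : 𝓞 K) ∉ v.asIdeal)
    (hIH : inertia (K := K) v ≤ H)
    (hH : ∀ g : absoluteGaloisGroup (v.adicCompletion K),
      (∀ χ : absoluteGaloisGroup (v.adicCompletion K) →ₜ* Multiplicative ℤ_[p], χ g = 1) →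
      absGaloisRestrict K (v.adicCompletion K) g ∈ H)
    (hunr : ∀ σ : absoluteGaloisGroup (v.adicCompletion K), σ ∈ absInertia (v.adicCompletion K) →
      θ (absGaloisRestrict K (v.adicCompletion K) σ) = 1)
    {φ : absoluteGaloisGroup (v.adicCompletion K)} (hφ : IsFrobPow φ 1)
    (hcong : ((unitChar θ (absGaloisRestrict K (v.adicCompletion K) φ) : ℤ_[p]ˣ) : ℤ_[p]) -
      (residueFieldCard (v.adicCompletion K) : ℤ_[p]) ∉ IsLocalRing.maximalIdeal ℤ_[p])
    (c : subgroupH1 H (charModule (∅ : Set (PadicAlgCl p)) θ))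
    (hpc : p • resH1Hom (inertiaInToH H v) (AddMonoidHom.id (charModule (∅ : Set (PadicAlgCl p)) θ))
      (fun _ _ ↦ rfl) c = 0) :
    resH1Hom (inertiaInToH H v) (AddMonoidHom.id (charModule (∅ : Set (PadicAlgCl p)) θ))
      (fun _ _ ↦ rfl) c = 0 := by
  set M := charModule (∅ : Set (PadicAlgCl p)) θ with hM
  haveI : CompactSpace (absoluteGaloisGroup (v.adicCompletion K)) :=
    absoluteGaloisGroup_compactSpace (v.adicCompletion K)
  -- the local action (through the chosen embedding), as a local instance of this proof only
  letI : DistribMulAction (absoluteGaloisGroup (v.adicCompletion K)) M :=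
    DistribMulAction.compHom _ (absGaloisRestrict K (v.adicCompletion K)).toMonoidHom
  have hstab := GreenbergSelmer.isOpen_stabilizer_cofree (p := p) (∅ : Set (PadicAlgCl p)) θ
  have hcont : ∀ m : M, Continuous fun σ : absoluteGaloisGroup K ↦ σ • m := fun m ↦
    continuous_smul_of_isOpen_stabilizer m (hstab m)
  let ρ : ContinuousRep (absoluteGaloisGroup (v.adicCompletion K)) ℤ M :=
    { toRepresentation :=
        (discreteContRep (absoluteGaloisGroup (v.adicCompletion K)) M).toRepresentation
      continuous_smul := by
        refine continuous_prod_of_discrete_right.mpr fun m ↦ ?_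
        change Continuous fun σ : absoluteGaloisGroup (v.adicCompletion K) ↦
          absGaloisRestrict K (v.adicCompletion K) σ • m
        exact (hcont m).comp (absGaloisRestrict K (v.adicCompletion K)).continuous_toFun }
  have hρ : ∀ (σ : absoluteGaloisGroup (v.adicCompletion K)) (m : M),
      ρ σ m = absGaloisRestrict K (v.adicCompletion K) σ • m := fun _ _ ↦ rfl
  -- inertia acts trivially
  have htriv : ∀ (τ : absInertia (v.adicCompletion K)) (m : M), τ • m = m := fun τ m ↦
    smul_eq_self_of_apply_eq_one θ (hunr τ.1 τ.2) m
  -- the surjection `ι : absInertia K_v ↠ H ∩ I_v` and injectivity of inflation along it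
  let ι : absInertia (v.adicCompletion K) →ₜ* inertiaIn H v :=
    { toFun := fun σ ↦ ⟨⟨absGaloisRestrict K (v.adicCompletion K) σ, ⟨σ, rfl⟩⟩,
        (mem_inertiaIn_iff H v _).2
          ⟨hIH (Subgroup.mem_map_of_mem _ σ.2), Subgroup.mem_map_of_mem _ σ.2⟩⟩
      map_one' := Subtype.ext (Subtype.ext (by simp))
      map_mul' := fun x y ↦ Subtype.ext (Subtype.ext (by simp))
      continuous_toFun := by
        refine Continuous.subtype_mk (Continuous.subtype_mk ?_ _) _
        exact (absGaloisRestrict K (v.adicCompletion K)).continuous_toFun.comp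
          continuous_subtype_val }
  have hι : Function.Surjective ι := by
    intro x
    obtain ⟨σ, hσ, hσx⟩ := Subgroup.mem_map.1 ((mem_inertiaIn_iff H v x.1).1 x.2).2
    exact ⟨⟨σ, hσ⟩, Subtype.ext (Subtype.ext hσx)⟩
  have hinj := Iwasawa.resH1Hom_injective_of_surjective (M := M) ι hι fun _ _ ↦ rfl
  -- the prime-to-`p` part `g` of `φ`; its restriction lies in `H`
  obtain ⟨g, hg⟩ := exists_mapClusterPt_pow_prime_pow_factorial φ p
  have hgH : absGaloisRestrict K (v.adicCompletion K) g ∈ H :=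
    hH g fun χ ↦ map_eq_one_of_mapClusterPt χ hg
  -- a cocycle of `c` and its inflation `f` to `absInertia K_v`
  obtain ⟨F, rfl⟩ := oneCocycleClass_surjective _ c
  rw [resH1Hom_oneCocycleClass] at hpc ⊢
  set F' := contOneCocycles.pullback (inertiaInToH H v)
    (resHomOfEquivariant (inertiaInToH H v) (AddMonoidHom.id M) (fun _ _ ↦ rfl)) F with hF'
  set f := contOneCocycles.pullback ι
    (resHomOfEquivariant ι (AddMonoidHom.id M) (fun _ _ ↦ rfl)) F' with hf
  have hres : resH1Hom ι (AddMonoidHom.id M) (fun _ _ ↦ rfl) (oneCocycleClass _ F') =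
      oneCocycleClass _ f := by rw [resH1Hom_oneCocycleClass]
  suffices hf0 : oneCocycleClass (discreteTopRep (absInertia (v.adicCompletion K)) M) f = 0 by
    apply hinj
    rw [hres, hf0, map_zero]
  have hfval : ∀ σ : absInertia (v.adicCompletion K),
      f.1 σ = F.1 ⟨absGaloisRestrict K (v.adicCompletion K) σ,
        hIH (Subgroup.mem_map_of_mem _ σ.2)⟩ := fun _ ↦ rfl
  -- `p • f = 0` pointwise (trivial action: no coboundaries)
  have hpf0 : p • oneCocycleClass (discreteTopRep (absInertia (v.adicCompletion K)) M) f = 0 := by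
    rw [← hres, ← map_nsmul, hpc, map_zero]
  have hev : ∀ (σ : absInertia (v.adicCompletion K)) (n : ℕ)
      (ψ : contOneCocycles (discreteTopRep (absInertia (v.adicCompletion K)) M)),
      (n • ψ).1 σ = n • ψ.1 σ := by
    intro σ n ψ
    induction n with
    | zero => simp only [zero_nsmul, ZeroMemClass.coe_zero, ContinuousMap.zero_apply]
    | succ n ih => simp only [succ_nsmul, AddMemClass.coe_add, ContinuousMap.add_apply, ih]
  have hpf : ∀ σ, p • f.1 σ = 0 := by
    intro σ
    rw [← oneCocycleClassₗ_apply, ← map_nsmul, oneCocycleClassₗ_apply,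
      oneCocycleClass_eq_zero_iff_of_trivial htriv] at hpf0
    rw [← hev, hpf0]
    rfl
  -- `f` is a continuous homomorphism (trivial action)
  have hf_mul : ∀ x y, f.1 (x * y) = f.1 x + f.1 y := cocycle_map_mul_of_trivial htriv f
  have hfc : Continuous f.1 := f.1.continuous
  -- `g` acts on `M[p]` like `φ`, i.e. as the integer `a = appr (θ(φ)) 1`
  obtain ⟨u, hu⟩ : ∃ u : ℤ_[p]ˣ, unitChar θ (absGaloisRestrict K (v.adicCompletion K) φ) = u :=
    ⟨_, rfl⟩
  obtain ⟨n, hn⟩ : ∃ n : ℕ, (u : ℤ_[p]).appr 1 = n := ⟨_, rfl⟩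
  have hga : ∀ d : M, (p : ℤ) • d = 0 → ρ g d = (n : ℤ) • d := by
    intro d hd
    rw [Nat.cast_smul_eq_nsmul] at hd
    have hgd : absGaloisRestrict K (v.adicCompletion K) g • d =
        absGaloisRestrict K (v.adicCompletion K) φ • d := by
      refine MapClusterPt.apply_eq_of_eventually_eq hg
        (f := fun x : absoluteGaloisGroup (v.adicCompletion K) ↦
          absGaloisRestrict K (v.adicCompletion K) x • d)
        ((hcont d).comp (absGaloisRestrict K (v.adicCompletion K)).continuous_toFun)
        (Eventually.of_forall fun k ↦ ?_)
      rw [map_pow]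
      exact pow_prime_pow_smul_eq_smul θ _ d hd _
    rw [hρ, hgd, smul_eq_appr_smul_of_prime_nsmul_eq_zero θ _ d hd, hu, hn, Nat.cast_smul_eq_nsmul]
  -- `p ∤ q − n` because `θ(φ) − q ∉ 𝔪` and `θ(φ) ≡ n (mod p)`
  have hcong' : ¬ ((p : ℤ) ∣ (residueFieldCard (v.adicCompletion K) : ℤ) - (n : ℤ)) := by
    rintro ⟨k, hk⟩
    apply hcong
    rw [hu]
    have h1 : (u : ℤ_[p]) - (n : ℤ_[p]) ∈ IsLocalRing.maximalIdeal ℤ_[p] := by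
      rw [PadicInt.maximalIdeal_eq_span_p, ← pow_one (p : ℤ_[p]), ← hn]
      exact PadicInt.appr_spec 1 _
    have h2 : (residueFieldCard (v.adicCompletion K) : ℤ_[p]) - (n : ℤ_[p]) ∈
        IsLocalRing.maximalIdeal ℤ_[p] := by
      rw [PadicInt.maximalIdeal_eq_span_p, Ideal.mem_span_singleton]
      refine ⟨(k : ℤ_[p]), ?_⟩
      have := congrArg (fun z : ℤ ↦ (z : ℤ_[p])) hk
      push_cast at this
      exact this
    have e : (u : ℤ_[p]) - (residueFieldCard (v.adicCompletion K) : ℤ_[p]) =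
        ((u : ℤ_[p]) - (n : ℤ_[p])) - ((residueFieldCard (v.adicCompletion K) : ℤ_[p]) - (n : ℤ_[p])) := by
      ring
    rw [e]
    exact Ideal.sub_mem _ h1 h2
  -- invariance under `g`: the cocycle identity of `F` at `res g ∈ H`
  let G : H := ⟨absGaloisRestrict K (v.adicCompletion K) g, hgH⟩
  have hinv : ∀ σ : absInertia (v.adicCompletion K),
      ρ g (f.1 ⟨g⁻¹ * (σ : absoluteGaloisGroup (v.adicCompletion K)) * g,
        (inferInstance : (absInertia (v.adicCompletion K)).Normal).conj_mem' _ σ.2 g⟩) = f.1 σ := by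
    intro σ
    let Sσ : H := ⟨absGaloisRestrict K (v.adicCompletion K) σ, hIH (Subgroup.mem_map_of_mem _ σ.2)⟩
    have hconj : f.1 ⟨g⁻¹ * (σ : absoluteGaloisGroup (v.adicCompletion K)) * g,
        (inferInstance : (absInertia (v.adicCompletion K)).Normal).conj_mem' _ σ.2 g⟩ =
        F.1 (G⁻¹ * Sσ * G) := by
      rw [hfval]
      congr 1
      refine Subtype.ext ?_
      change absGaloisRestrict K (v.adicCompletion K)
          (g⁻¹ * (σ : absoluteGaloisGroup (v.adicCompletion K)) * g) = _
      rw [map_mul, map_mul, map_inv]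
      rfl
    have h1 : F.1 (Sσ * G) =
        F.1 G + (absGaloisRestrict K (v.adicCompletion K) g) • F.1 (G⁻¹ * Sσ * G) := by
      have h := F.2 G (G⁻¹ * Sσ * G)
      have hmulG : G * (G⁻¹ * Sσ * G) = Sσ * G := by group
      rw [hmulG] at h
      exact h
    have h2 : F.1 (Sσ * G) = F.1 Sσ + (absGaloisRestrict K (v.adicCompletion K) σ) • F.1 G := F.2 Sσ G
    rw [smul_eq_self_of_apply_eq_one θ (hunr σ σ.2)] at h2
    rw [hρ, hconj, hfval σ]
    have e1 : (absGaloisRestrict K (v.adicCompletion K) g) • F.1 (G⁻¹ * Sσ * G) =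
        F.1 (Sσ * G) - F.1 G := by rw [h1]; abel
    rw [e1, h2]
    abel
  -- conclude with the abstract lemma
  haveI := finite_submoduleTorsionBy_charModule θ
  have hℓ := ringChar_residueField_prime (F := v.adicCompletion K)
  have hne := v.ringChar_residueField_adicCompletion_ne hpv
  have hcop : p.Coprime (ringChar 𝓀[v.adicCompletion K]) := (Nat.coprime_primes hp.out hℓ).2 (Ne.symm hne)
  have hzero := hom_apply_eq_zero_of_conj (v.adicCompletion K) ρ hcop hφ hg (n : ℤ) hga hcong' f.1
    hf_mul hfc hpf hinv
  have hf0 : f = 0 := Subtype.ext (ContinuousMap.ext hzero)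
  rw [hf0]
  exact oneCocycleClass_zero _

/-! ## §2 The per-place corank bound `c_v ≤ 𝟙[FrobActsAsNormAt ∅ θ v]` over a `ℤ_p`-extension -/

/-- **`θ` unramified at `v` kills the local inertia group** `res (I_{K_v}) = I_{𝔓₀}`
(`inertia_adicCompletionPrime_eq_map_absInertia`). [cite: NeukirchANT1999, Ch. II §9 Prop. (9.6)] -/
theorem apply_absGaloisRestrict_eq_one_of_isUnramifiedAt (hunr : θ.IsUnramifiedAt v)
    {σ : absoluteGaloisGroup (v.adicCompletion K)} (hσ : σ ∈ absInertia (v.adicCompletion K)) :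
    θ (absGaloisRestrict K (v.adicCompletion K) σ) = 1 := by
  refine hunr _ (adicCompletionPrime_mem_primesAbove K v) _ ?_
  rw [inertia_adicCompletionPrime_eq_map_absInertia]
  exact Subgroup.mem_map_of_mem _ hσ

/-- **`θ` unramified at `v` with `θ(Frob) − Nv ∈ 𝔪_{ℤ_p}` for a local Frobenius means
`FrobActsAsNormAt ∅ θ v`**: the entry `θ(res φ)₀₀ = e(unitChar θ (res φ))` is the Frobenius value
(`hasFrobCharpolyAt_entry_of_isUnramifiedAt`, `isArithFrobAt_absGaloisRestrict_adicCompletionPrime_iff`)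
and `e : ℤ_p ≅ 𝒪_{ℚ_p(∅)}` is an isometry into `ℚ̄_p`. [cite: KellerYin2024, Lemma 1.1.1 (arXiv:2402.12781v2 TeX L455–462)] -/
theorem frobActsAsNormAt_of_sub_mem_maximalIdeal (hunr : θ.IsUnramifiedAt v)
    {φ : absoluteGaloisGroup (v.adicCompletion K)} (hφ : IsFrobPow φ 1)
    (hmem : ((unitChar θ (absGaloisRestrict K (v.adicCompletion K) φ) : ℤ_[p]ˣ) : ℤ_[p]) -
      (residueFieldCard (v.adicCompletion K) : ℤ_[p]) ∈ IsLocalRing.maximalIdeal ℤ_[p]) :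
    FrobActsAsNormAt (∅ : Set (PadicAlgCl p)) θ v := by
  have hq : residueFieldCard (v.adicCompletion K) = Nat.card (𝓞 K ⧸ v.asIdeal) := by
    rw [Literature.NumberTheory.Automorphic.residueFieldCard_adicCompletion_eq,
      v.residueCard_eq_card_quotient]
  have hfrob : IsArithFrobAt (𝓞 K) (absGaloisRestrict K (v.adicCompletion K) φ)
      (adicCompletionPrime K v) :=
    (isArithFrobAt_absGaloisRestrict_adicCompletionPrime_iff K v hq φ).mpr
      (isFrobPow_one_iff_isAbsArithFrob_holds.mp hφ)
  refine ⟨hunr, entry (∅ : Set (PadicAlgCl p)) θ (absGaloisRestrict K (v.adicCompletion K) φ),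
    IwasawaTwoVariable.hasFrobCharpolyAt_entry_of_isUnramifiedAt hunr
      (adicCompletionPrime_mem_primesAbove K v) hfrob, ?_⟩
  -- the norm in `ℚ̄_p` is the norm in `ℤ_p`
  have hentry : entry (∅ : Set (PadicAlgCl p)) θ (absGaloisRestrict K (v.adicCompletion K) φ) =
      padicIntEquivCoeffIntegersEmpty p
        ((unitChar θ (absGaloisRestrict K (v.adicCompletion K) φ) : ℤ_[p]ˣ) : ℤ_[p]) :=
    (padicIntEquiv_unitChar θ _).symm
  have hN : (v.asIdeal.absNorm : PadicAlgCl p) =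
      algebraMap ℚ_[p] (PadicAlgCl p)
        (((residueFieldCard (v.adicCompletion K) : ℤ_[p]) : ℚ_[p])) := by
    rw [PadicInt.coe_natCast, map_natCast, hq, Ideal.absNorm_apply, Submodule.cardQuot_apply]
  rw [hentry, coe_padicIntEquivCoeffIntegersEmpty, hN, ← map_sub, norm_algebraMap',
    ← PadicInt.coe_sub]
  change ‖((unitChar θ (absGaloisRestrict K (v.adicCompletion K) φ) : ℤ_[p]ˣ) : ℤ_[p]) -
    (residueFieldCard (v.adicCompletion K) : ℤ_[p])‖ < 1
  rw [← PadicInt.mem_nonunits, ← IsLocalRing.mem_maximalIdeal]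
  exact hmem

/-- **The per-place input `hloc` of `UnrSelmerQuotientCorankLeGeneric.zpCorank_quotient_le_sum` for
Keller–Yin's `(F/𝒪)(θ)`, `θ^{p−1} = 1`, over a `ℤ_p`-extension `κ` (`H = ker κ`) at `v ∤ p`**: every
subgroup `Y` of the image of `r_v : H¹(K_∞, (F/𝒪)(θ)) → H¹(I_w(K_∞), (F/𝒪)(θ))` has
`zpCorank Y p ≤ (if FrobActsAsNormAt ∅ θ v then 1 else 0)` — so that `N_v · c_v =
numPlacesAbove κ v · 𝟙[…] = charLocalLambda ∅ κ θ v`. The bound `1` is `#H¹(I_w, M)[p] ≤ p`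
(`natCard_torsionBy_discreteH1_inertiaIn_charModule_le`); the bound `0`: if `θ` ramifies at `v`
there is no `p`-torsion at all (`eq_zero_of_prime_nsmul_eq_zero_of_not_isUnramifiedAt`), and if `θ`
is unramified with `θ(Frob_v) ≢ Nv (mod 𝔭)` the image has no `p`-torsion (§1, the prime-to-`p` part of
Frobenius lying in `ker κ`). This is the UPPER-BOUND half of KY / CGLS Lemma 1.1.1
("`H¹(K_w, M_θ)^∨` is `Λ`-torsion with characteristic ideal `(𝒫_w(θ))`", `λ(𝒫_w(θ)) =
[Γ : Γ_w] · 𝟙[θ(Frob_w) ≡ ℓ]`) per place of `K_∞` above `v`, in the kernel.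
[cite: KellerYin2024, Lemma 1.1.1 (arXiv:2402.12781v2 TeX L455–462)] [cite: CastellaGrossiLeeSkinner2022, Lemma 1.1.1]
[cite: GreenbergVatsal2000, §2 Prop. (2.4) pp. 22–23] -/
theorem zpCorank_le_ite_of_forall_exists (κ : ZpExtension K p)
    (hθ : ∀ σ : absoluteGaloisGroup K, θ σ ^ (p - 1) = 1) (hpv : (p : 𝓞 K) ∉ v.asIdeal)
    (Y : AddSubgroup (discreteH1 (inertiaIn κ.kerSubgroup v) (charModule (∅ : Set (PadicAlgCl p)) θ)))
    (hY : ∀ y ∈ Y, ∃ x : subgroupH1 κ.kerSubgroup (charModule (∅ : Set (PadicAlgCl p)) θ),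
      resH1Hom (inertiaInToH κ.kerSubgroup v) (AddMonoidHom.id (charModule (∅ : Set (PadicAlgCl p)) θ))
        (fun _ _ ↦ rfl) x = y) :
    zpCorank Y p ≤ if FrobActsAsNormAt (∅ : Set (PadicAlgCl p)) θ v then 1 else 0 := by
  have hIH : inertia (K := K) v ≤ κ.kerSubgroup := Iwasawa.inertia_le_kerSubgroup' κ v hpv
  split_ifs with hF
  · -- `≤ 1`: `Y[p] ↪ H¹(I_w, M)[p]`, of order `≤ p`
    obtain ⟨hfin, hcard⟩ :=
      natCard_torsionBy_discreteH1_inertiaIn_charModule_le θ κ.kerSubgroup v hpv hIH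
    haveI := hfin
    let j : (↥Y)[(p : ℤ)] →
        (discreteH1 (inertiaIn κ.kerSubgroup v) (charModule (∅ : Set (PadicAlgCl p)) θ))[(p : ℤ)] :=
      fun y ↦ ⟨((y : Y) : _), by
        rw [AddSubgroup.torsionBy.nsmul_iff, ← AddSubmonoidClass.coe_nsmul,
          AddSubgroup.torsionBy.nsmul_iff.1 y.2, ZeroMemClass.coe_zero]⟩
    have hj : Function.Injective j := fun a b hab ↦ by
      have h := congrArg Subtype.val hab
      exact Subtype.ext (Subtype.ext h)
    haveI : Finite ((↥Y)[(p : ℤ)]) := Finite.of_injective j hj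
    exact zpCorank_le_one_of_natCard_torsionBy_le ((Nat.card_le_card_of_injective j hj).trans hcard)
  · -- `= 0`: no `p`-torsion in `Y`
    refine le_of_eq (zpCorank_eq_zero_of_torsionBy_trivial fun y hy ↦ ?_)
    have hy' : p • ((y : Y) : discreteH1 (inertiaIn κ.kerSubgroup v)
        (charModule (∅ : Set (PadicAlgCl p)) θ)) = 0 := by
      rw [← AddSubmonoidClass.coe_nsmul, hy, ZeroMemClass.coe_zero]
    apply Subtype.ext
    change ((y : Y) : discreteH1 (inertiaIn κ.kerSubgroup v) (charModule (∅ : Set (PadicAlgCl p)) θ)) = 0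
    by_cases hram : θ.IsUnramifiedAt v
    · -- unramified: `θ(Frob_v) ≢ Nv`, the image of `r_v` has no `p`-torsion (§1)
      obtain ⟨x, hx⟩ := hY _ y.2
      obtain ⟨φ, hφ⟩ := exists_isFrobPow_holds (F := v.adicCompletion K) 1
      have hcong : ((unitChar θ (absGaloisRestrict K (v.adicCompletion K) φ) : ℤ_[p]ˣ) : ℤ_[p]) -
          (residueFieldCard (v.adicCompletion K) : ℤ_[p]) ∉ IsLocalRing.maximalIdeal ℤ_[p] :=
        fun hmem ↦ hF (frobActsAsNormAt_of_sub_mem_maximalIdeal θ v hram hφ hmem)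
      rw [← hx] at hy' ⊢
      exact resH1Hom_inertiaIn_eq_zero_of_prime_nsmul_eq_zero θ κ.kerSubgroup v hpv hIH
        (fun _ hg ↦ ZpExtension.mem_kerSubgroup.mpr
          (hg (κ.toContinuousMonoidHom.comp (absGaloisRestrict K (v.adicCompletion K)))))
        (fun σ hσ ↦ apply_absGaloisRestrict_eq_one_of_isUnramifiedAt θ v hram hσ) hφ hcong x hy'
    · -- ramified: no `p`-torsion at all
      exact eq_zero_of_prime_nsmul_eq_zero_of_not_isUnramifiedAt θ κ.kerSubgroup v hθ hpv hIH hram _ hy'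

end Summit.BirchSwinnertonDyer.BirchSwinnertonDyer.Theorems.CharLocalInertiaFrobenius

end
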